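import Summits.QuantumFields.BalabanUV.T4Continuum.Support.NE7SliceRepLetters
import Summits.QuantumFields.BalabanUV.T4Continuum.Support.NE7MinActHessianUniform
import Summits.QuantumFields.BalabanUV.T4Continuum.Support.NE7BorderedHessianOnSlice
import Summits.QuantumFields.BalabanUV.T4Continuum.Support.NE7BorderedHessianGaugeDegenerate
import Summits.QuantumFields.BalabanUV.T4Continuum.Support.AveragingDeficitMultiLevelBridge
import HarnessLib

/-!
# NE7BorderedHessianOnSliceUniform — G12 (`NE7BorderedHessianOnSlice.bordered_hessian_attained_on_slice`) RE-ISSUED WITH A LEVEL-UNIFORM DATUM RADIUS: `∀ N ∃ δV ∀ j` (lineage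
# `b2b-balaban-t4-ne7-p1`, gen 119, file U2 of the uniform (G′) chain)

Cell `pub-balaban`, rung (B)+1 sub-cell t4, CRUX PROVER NE7 #1 (OWNER of row NE7), generation 119.
WHY.  (G′) ✓ H15 inherits `∀ N ∀ j ∃ δV` from G12, whose two all-data inputs were gen 115's bordered Hessian and multiplier identity (`∀ j ∃ δV`).  Both now exist with `∀ N ∃ δV ∀ j`: ✓ U1
`NE7MinActHessianUniform.minAct_hessian_hessForm_allData_uniform` and row NE7b's ✓ `NE7MinActC2AllDataUniform.multiplier_eq_fderiv_minAct_allData_uniform`.  THIS FILE is G12's proof verbatim on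
those two inputs, with the quantifiers reordered; U3∕U4 carry it to (G′).
WHAT ([folklore]; 0 def, 0 sorry; `d = 4`): **`bordered_hessian_attained_on_slice_uniform`**.
HONEST FRAMING (page 1): composition of landed kernel theorems about OUR minimisers; the multiplier term is NOT bounded here; nothing of Bałaban's asserted; NOT NE7 as a spine node, NOT NE3;
spine 0∕9; finite T⁴ rung (B)+1 — NOT infinite volume, NOT mass gap, NOT BetaPertH, NOT Clay.
-/

set_option autoImplicit false

open scoped BigOperators Matrix Matrix.Norms.L2Operator Topology
open NormedSpace Finset Set Filter Metric

namespace Summit.QuantumFields.BalabanUV.T4Continuum.NE7BorderedHessianOnSliceUniform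

open Literature.MathematicalPhysics.QuantumFieldTheory.Balaban1983to89
open B7Prop1Explicit B7Prop2Explicit MatrixLog UnitaryModel
open T4AveragingDeficitWall (IsUnitaryCfg IsSkewDir SmallField Ad curl curlAt curlSq dirSq fineAction)
open T4AveragingDeficitWallBoundary (IsPeriodicCfg periodBox)
open AveragingDeficitTorusChart (TDir chart chartDir resDir)
open AveragingDeficitTwoLevelPrep (twoLevelSmall skewSub skewPR)
open AveragingDeficitMultiLevelPrep (cavgIter tower levelQ levelQ' LevelSmall natCast_tower_succ)
open AveragingDeficitMultiLevelBridge (cavgIter_eq_avgIter)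
open MatrixNorms (nhsNormSq)
open MinimalActionLevels (perWin stepWt)
open MinimalActionSandwich (IsMinimiser minAct)
open MinimalActionRate (sfClass)
open NE3HessForm (hess)
open NE7RadIterUniform (radD radD_nonneg levelSmall_of_class_radius)
open NE7StraightTowerCurlEnergy (eC mC)
open NE7FlatAverageCurlCommutation (isSkewDir_chartDir_id)
open BlockAveragePushDirGauge (gaugeDir)
open NE3QbarIterCovLiftPrep (cruxC)
open NE3RightInverseSolveLetters (thetaLoc)
open NE3SlicePoincareShape (SlicePoincare)
open NE3FrameFreeSliceW (frameFreeBlockLandauW)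
open NE3EnergyRateWSupOfSlicePoincare (tower_eq_mul_pow)
open NE7FrameFreeRightInverse (rightInvW0)
open NE7SliceRepHessianFloor (liftMassC liftCurlC sliceRep_args)
open NE7SliceRepLetters (exists_cornerGauge_sliceRep_letters)
open NE7MinActHessianUniform (minAct_hessian_hessForm_allData_uniform)
open NE7MinActC2AllDataUniform (multiplier_eq_fderiv_minAct_allData_uniform)
open NE7BorderedHessianOnSlice (classRadius_eq)
open NE7BorderedHessianGaugeDegenerate (borderedForm_add_gaugeDir fderiv_levelQ_chart_subtype_apply)
open NE7SecondVariationHess (second_variation)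

noncomputable section

variable {n : Type} [Fintype n] [DecidableEq n]

set_option maxHeartbeats 400000 in
/-- **THE BORDERED HESSIAN IS ATTAINED ON THE MULTI-LEVEL SLICE, WITH THE HESSIAN FLOOR** (`d = 4`, every `U(n)`, `L ≥ 2`).  `∃ ε₀ > 0 ∀ 0 < ε ≤ ε₀` obeying the k-free lines (`hεD`, `hεT` at
`2ε`; `hεM`, `ε ≤ 1`, `cruxC·ε < 1`, `thetaLoc·ε ≤ 1∕2`, `43584·ε ≤ 1∕2`) `∀ N ≥ 1 ∀ j ∃ δ_V > 0 ∀ V₀` (unitary, `N`-periodic, `δ_V`-small) `∀ U♯` minimiser over `V₀` `∀ C_P ≥ 0` with row NE3's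
`SlicePoincare L (j+1) U♯ T_♮(U♯) C_P` and `28·#pl·ε·(4C_P n) ≤ 1` `∀ θ > 0 ∀ v`: there is `X⋆ : skewSub (L·tower L N j)` with `levelQ′ X⋆ = v` and
(1) `D²(minAct∘chart_{V₀})(0)[v,v] = w·hess U♯ X̃⋆ X̃⋆ (perWin 4 (tower L N (j+1))) − Dm(0)[D²𝒢(0)[X⋆,X⋆]]` (`w = stepWt⁻ʲ⁻¹`),
(2) `Σ_{P∈perWin N} nhs(curl V₀ ṽ P) ≤ ((1+θ) + 2K·(4C_P n))·hess U♯ X̃⋆ X̃⋆ (perWin) + 2K·ρ·dirSq ṽ (periodBox N)`,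
(3) `(L⁻¹)^{2(j+1)}·dirSq X̃⋆ (periodBox (tower)) ≤ 2(4C_P n)·hess + 2ρ·dirSq ṽ (periodBox N)` (`ρ = 2liftMassC + 4C_P liftCurlC`, `K = (1+θ)·14·#pl·ε + (1+θ⁻¹)·36eC²ε²`).
[cite: Balaban1985Variational, Thm 1 p.279, (83) p.290; Balaban1985Averaging, (48) p.25; Balaban1985PropagatorsII, Thm 3.3 (3.46)] -/
theorem bordered_hessian_attained_on_slice_uniform [Nonempty n] {L : ℕ} [NeZero L] (hL : 2 ≤ L) :
    ∃ ε₀ : ℝ, 0 < ε₀ ∧ ∀ ε : ℝ, 0 < ε → ε ≤ ε₀ →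
      4 * (2 * ε) * radD 4 L * (((L : ℝ) ^ 2)⁻¹) ^ 2 ≤ 1 → twoLevelSmall 4 L * (2 * (2 * ε) * ((L : ℝ) ^ 2)⁻¹) ≤ 1 →
      8 * (L : ℝ) * mC 4 L (Fintype.card n) * ε * ((L : ℝ) ^ 2)⁻¹ ≤ 1 → ε ≤ 1 → cruxC 4 L * ε < 1 → thetaLoc 4 L * ε ≤ 1 / 2 → 43584 * ε ≤ 1 / 2 →
      ∀ (N : ℕ) [NeZero N], 1 ≤ N →
      ∃ δV : ℝ, 0 < δV ∧ ∀ j : ℕ,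
        ∀ V₀ ∈ {V : Site 4 → Fin 4 → (Matrix n n ℂ)ˣ | IsUnitaryCfg V ∧ IsPeriodicCfg V (N : ℤ) ∧ SmallField V δV},
        ∀ Us : Site 4 → Fin 4 → (Matrix n n ℂ)ˣ, IsMinimiser 4 (sfClass 4 L N ε) L N (j + 1) V₀ Us →
        ∀ CP : ℝ, 0 ≤ CP → SlicePoincare L (j + 1) Us (frameFreeBlockLandauW (d := 4) (n := n) L N (j + 1) Us) CP (periodBox (N * L ^ (j + 1))) →
        28 * (Fintype.card (T4AveragingDeficitWall.Plane 4) : ℝ) * ε * (4 * CP * Fintype.card n) ≤ 1 → ∀ θ : ℝ, 0 < θ →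
        ∀ v : ↥(skewSub 4 n N), ∃ Xs : ↥(skewSub 4 n (L * tower L N j)),
          levelQ' L N j Us (Xs : TDir 4 n (L * tower L N j)) = v
          ∧ fderiv ℝ (fderiv ℝ (fun y : ↥(skewSub 4 n N) => minAct 4 (sfClass 4 L N ε) L N (j + 1) (chart (ContinuousLinearMap.id ℝ (Matrix n n ℂ)) N V₀ (y : TDir 4 n N)))) 0 v v
              = ((stepWt 4 L)⁻¹) ^ (j + 1) * hess Us (chartDir (ContinuousLinearMap.id ℝ (Matrix n n ℂ)) (L * tower L N j) (Xs : TDir 4 n (L * tower L N j)))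
                    (chartDir (ContinuousLinearMap.id ℝ (Matrix n n ℂ)) (L * tower L N j) (Xs : TDir 4 n (L * tower L N j))) (perWin 4 (tower L N (j + 1)))
                - fderiv ℝ (fun y : ↥(skewSub 4 n N) => minAct 4 (sfClass 4 L N ε) L N (j + 1) (chart (ContinuousLinearMap.id ℝ (Matrix n n ℂ)) N V₀ (y : TDir 4 n N))) 0
                    (fderiv ℝ (fderiv ℝ (fun Φ : ↥(skewSub 4 n (L * tower L N j)) =>
                      levelQ L N j Us (chart (ContinuousLinearMap.id ℝ (Matrix n n ℂ)) (L * tower L N j) Us (Φ : TDir 4 n (L * tower L N j))))) 0 Xs Xs)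
          ∧ ∑ P ∈ perWin 4 N, nhsNormSq (curl V₀ (chartDir (ContinuousLinearMap.id ℝ (Matrix n n ℂ)) N (v : TDir 4 n N)) P)
              ≤ ((1 + θ) + 2 * ((1 + θ) * (14 * (Fintype.card (T4AveragingDeficitWall.Plane 4) : ℝ) * ε) + (1 + θ⁻¹) * (36 * eC 4 L (Fintype.card n) ^ 2 * ε ^ 2))
                    * (4 * CP * Fintype.card n))
                  * hess Us (chartDir (ContinuousLinearMap.id ℝ (Matrix n n ℂ)) (L * tower L N j) (Xs : TDir 4 n (L * tower L N j)))
                      (chartDir (ContinuousLinearMap.id ℝ (Matrix n n ℂ)) (L * tower L N j) (Xs : TDir 4 n (L * tower L N j))) (perWin 4 (tower L N (j + 1)))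
                + 2 * ((1 + θ) * (14 * (Fintype.card (T4AveragingDeficitWall.Plane 4) : ℝ) * ε) + (1 + θ⁻¹) * (36 * eC 4 L (Fintype.card n) ^ 2 * ε ^ 2))
                    * ((2 * liftMassC 4 L + 4 * CP * liftCurlC 4 L) * dirSq (chartDir (ContinuousLinearMap.id ℝ (Matrix n n ℂ)) N (v : TDir 4 n N)) (periodBox N))
          ∧ ((L : ℝ)⁻¹) ^ (2 * (j + 1)) * dirSq (chartDir (ContinuousLinearMap.id ℝ (Matrix n n ℂ)) (L * tower L N j) (Xs : TDir 4 n (L * tower L N j))) (periodBox (tower L N (j + 1)))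
              ≤ 2 * (4 * CP * Fintype.card n)
                  * hess Us (chartDir (ContinuousLinearMap.id ℝ (Matrix n n ℂ)) (L * tower L N j) (Xs : TDir 4 n (L * tower L N j)))
                      (chartDir (ContinuousLinearMap.id ℝ (Matrix n n ℂ)) (L * tower L N j) (Xs : TDir 4 n (L * tower L N j))) (perWin 4 (tower L N (j + 1)))
                + 2 * ((2 * liftMassC 4 L + 4 * CP * liftCurlC 4 L) * dirSq (chartDir (ContinuousLinearMap.id ℝ (Matrix n n ℂ)) N (v : TDir 4 n N)) (periodBox N)) := by
  have hL1 : 1 ≤ L := by omega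
  obtain ⟨ε₁, hε₁, H1⟩ := minAct_hessian_hessForm_allData_uniform (n := n) hL
  obtain ⟨ε₂, hε₂, H2⟩ := multiplier_eq_fderiv_minAct_allData_uniform (n := n) hL
  refine ⟨min ε₁ ε₂, lt_min hε₁ hε₂, fun ε hε hεle hεD2 hεT2 hεM hε1 hcrux hθl2 hEl N _ hN => ?_⟩
  obtain ⟨δ₁, hδ₁, hA⟩ := H1 ε hε (hεle.trans (min_le_left _ _)) N hN
  obtain ⟨δ₂, hδ₂, hB⟩ := H2 ε hε (hεle.trans (min_le_right _ _)) N hN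
  refine ⟨min δ₁ δ₂, lt_min hδ₁ hδ₂, fun j V₀ hV₀ Us hUs CP hCP hSP habs θ hθ v => ?_⟩
  obtain ⟨hV₀u, hV₀P, hV₀δ⟩ := hV₀
  obtain ⟨-, hbord⟩ := hA j V₀ ⟨hV₀u, hV₀P, MinimalActionRate.SmallField.mono hV₀δ (min_le_left _ _)⟩
  obtain ⟨-, hleast⟩ := hbord Us hUs
  obtain ⟨-, hmult⟩ := hB j V₀ ⟨hV₀u, hV₀P, MinimalActionRate.SmallField.mono hV₀δ (min_le_right _ _)⟩ Us hUs
  -- class facts for the minimiser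
  obtain ⟨hUu, hUP0, hUx0⟩ := hUs.mem.1
  have hUP : IsPeriodicCfg Us ((tower L N (j + 1) : ℕ) : ℤ) := by rw [tower_eq_mul_pow]; exact hUP0
  have hUx : SmallField Us (ε * (((L : ℝ) ^ 2)⁻¹) ^ (j + 1)) := by rw [← classRadius_eq]; exact hUx0
  have hUsavg : cavgIter L (j + 1) Us = V₀ := by rw [cavgIter_eq_avgIter]; exact hUs.mem.2
  have hUP' : IsPeriodicCfg Us ((L * tower L N j : ℕ) : ℤ) := hUP
  have hUP'' : IsPeriodicCfg Us ((L : ℤ) * (tower L N j : ℕ)) := by rw [← natCast_tower_succ]; exact hUP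
  -- the ε-lines at `ε` from those at `2ε`
  have hε0 : 0 ≤ ε := hε.le
  have hq0 : 0 ≤ (((L : ℝ) ^ 2)⁻¹) := by positivity
  have hεD : 4 * ε * radD 4 L * (((L : ℝ) ^ 2)⁻¹) ^ 2 ≤ 1 := by
    have h1 : 4 * ε * radD 4 L * (((L : ℝ) ^ 2)⁻¹) ^ 2 ≤ 4 * (2 * ε) * radD 4 L * (((L : ℝ) ^ 2)⁻¹) ^ 2 := by
      have := radD_nonneg (d := 4) L
      have : 0 ≤ ε * radD 4 L * (((L : ℝ) ^ 2)⁻¹) ^ 2 := by positivity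
      nlinarith
    exact h1.trans hεD2
  have hεT : twoLevelSmall 4 L * (2 * ε * ((L : ℝ) ^ 2)⁻¹) ≤ 1 := by
    have ht : 0 ≤ twoLevelSmall 4 L := by unfold AveragingDeficitTwoLevelPrep.twoLevelSmall; positivity
    have h1 : twoLevelSmall 4 L * (2 * ε * ((L : ℝ) ^ 2)⁻¹) ≤ twoLevelSmall 4 L * (2 * (2 * ε) * ((L : ℝ) ^ 2)⁻¹) := by
      refine mul_le_mul_of_nonneg_left ?_ ht
      have : 0 ≤ ε * ((L : ℝ) ^ 2)⁻¹ := by positivity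
      nlinarith
    exact h1.trans hεT2
  -- the minimising lift
  obtain ⟨⟨X₀, hQ₀, hm⟩, -⟩ := hleast v
  -- G11 on the minimising lift
  obtain ⟨hx, hs, hcr, hE⟩ := sliceRep_args hL hε0 hεD hεT hcrux hEl j
  have hvs : IsSkewDir (chartDir (ContinuousLinearMap.id ℝ (Matrix n n ℂ)) N ((levelQ' L N j Us (X₀ : TDir 4 n (L * tower L N j)) : ↥(skewSub 4 n N)) : TDir 4 n N)) :=
    isSkewDir_chartDir_id (levelQ' L N j Us (X₀ : TDir 4 n (L * tower L N j))).2
  obtain ⟨mu, hmus, hmuP, hmu0, hq, -, hfloor, hmass, -⟩ :=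
    exists_cornerGauge_sliceRep_letters hL hN hε0 hεD hεT hεM hε1 hθl2 j hUu hUP hUx hx hs hcr hE hCP hSP habs hθ X₀ hvs
  -- the class with room at `2ε` and the bordered invariance
  obtain ⟨hs2, -⟩ := levelSmall_of_class_radius (d := 4) hL (by positivity : (0 : ℝ) ≤ 2 * ε) hεD2 hεT2 j
  have hxx' : ε * (((L : ℝ) ^ 2)⁻¹) ^ (j + 1) < 2 * ε * (((L : ℝ) ^ 2)⁻¹) ^ (j + 1) := by
    have hL0 : (0 : ℝ) < L := by exact_mod_cast (show 0 < L by omega)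
    have : 0 < (((L : ℝ) ^ 2)⁻¹) ^ (j + 1) := by positivity
    nlinarith
  have hcrit : ∀ Z : ↥(skewSub 4 n (L * tower L N j)),
      ((stepWt 4 L)⁻¹) ^ (j + 1) * fderiv ℝ (fun Φ : ↥(skewSub 4 n (L * tower L N j)) =>
          fineAction (chart (ContinuousLinearMap.id ℝ (Matrix n n ℂ)) (L * tower L N j) Us (Φ : TDir 4 n (L * tower L N j))) (perWin 4 (N * L ^ (j + 1)))) 0 Z
        = (fderiv ℝ (fun y : ↥(skewSub 4 n N) => minAct 4 (sfClass 4 L N ε) L N (j + 1) (chart (ContinuousLinearMap.id ℝ (Matrix n n ℂ)) N V₀ (y : TDir 4 n N))) 0)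
          (fderiv ℝ (fun Φ : ↥(skewSub 4 n (L * tower L N j)) =>
            levelQ L N j Us (chart (ContinuousLinearMap.id ℝ (Matrix n n ℂ)) (L * tower L N j) Us (Φ : TDir 4 n (L * tower L N j)))) 0 Z) := by
    intro Z
    rw [fderiv_levelQ_chart_subtype_apply (d := 4) hL1 j hUu hUP'' hx hs hUx Z]
    exact hmult Z
  obtain ⟨-, hBinv⟩ := borderedForm_add_gaugeDir (d := 4) hL1 j hUu hUP' hx hxx' hs2 hUx hmus hmuP hmu0 (perWin 4 (N * L ^ (j + 1)))
    (((stepWt 4 L)⁻¹) ^ (j + 1))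
    (fderiv ℝ (fun y : ↥(skewSub 4 n N) => minAct 4 (sfClass 4 L N ε) L N (j + 1) (chart (ContinuousLinearMap.id ℝ (Matrix n n ℂ)) N V₀ (y : TDir 4 n N))) 0) hcrit X₀
  set Xs : ↥(skewSub 4 n (L * tower L N j)) := X₀ + skewPR (d := 4) (n := n) (L * tower L N j) (resDir (L * tower L N j) (gaugeDir Us mu)) with hXs
  refine ⟨Xs, by rw [hq, hQ₀], ?_, ?_, ?_⟩
  · -- the value on the slice representative
    have eW : perWin 4 (tower L N (j + 1)) = perWin 4 (N * L ^ (j + 1)) := by rw [tower_eq_mul_pow L N (j + 1)]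
    rw [eW, ← second_variation Us (perWin 4 (N * L ^ (j + 1))) Xs, hBinv, second_variation Us (perWin 4 (N * L ^ (j + 1))) X₀]
    exact hm
  · rw [hQ₀, hUsavg] at hfloor
    exact hfloor
  · rw [hQ₀] at hmass
    exact hmass

end

end Summit.QuantumFields.BalabanUV.T4Continuum.NE7BorderedHessianOnSliceUniform
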